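import Literature.Computability.AlgebraicComplexity.PolynomialKoszulYoungFlattening
import Literature.Barriers.ValiantsHypothesis.ShiftedPartialsMonotone
import Literature.Barriers.ValiantsHypothesis.ShiftedPartialsDegenerations
import Mathlib.LinearAlgebra.Matrix.Rank
import Mathlib.LinearAlgebra.FiniteDimensional.Basic
import HarnessLib

/-!
# Koszul–Young flattenings of a form: the coefficient matrix, `rank = Matrix.rank`, and the
# transpose duality `rank P^{∧p}_{k,d-k} = rank P^{∧(N-1-p)}_{d-1-k,k+1}`

Topic `Literature/Computability/AlgebraicComplexity`; companion of `PolynomialKoszulYoungFlattening.lean`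
(`kyImage`, `kyImages`, `kyRankFin`). Everything here is PROVED; no named facts.

**The statement.** For a FORM `P ∈ S^dW` (`dim W = N`, characteristic `0`) and `0 ≤ p ≤ N-1`, `0 ≤ k ≤ d-1`, the
Koszul–Young flattenings `P^{∧p}_{k,d-k} : S^kW^* ⊗ Λ^pW → S^{d-k-1}W ⊗ Λ^{p+1}W` and
`P^{∧(N-1-p)}_{d-1-k,k+1} : S^{d-1-k}W^* ⊗ Λ^{N-1-p}W → S^{k}W ⊗ Λ^{N-p}W` have the SAME RANK (`kyRankFin_dual`). Reason: in the
monomial bases the two matrices are transposes of each other up to invertible diagonal scalings. The entry of the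
first at row `(x^β, e_T)`, column `(∂^α, e_S)` is `[T = S ⊔ t]·ε(S,t)·((α+β+e_t)!/β!)·P_{α+β+e_t}`, the entry of the second
at row `(x^α, e_{W∖S})`, column `(∂^β, e_{W∖T})` is `[W∖S = (W∖T) ⊔ t]·ε(W∖T,t)·((α+β+e_t)!/α!)·P_{α+β+e_t}` with the same
`t`, and `ε(S,t)·ε(W∖T,t) = (-1)^{t} = (-1)^{Σ T}(-1)^{Σ S}` — so the ratio is a product of a function of the row and a
function of the column. This is the `Λ^{p+1}W ≅ (Λ^{N-p-1}W)^* ⊗ Λ^NW`, `S^kW ≅ (S^kW^*)^*` self-duality familiar for Koszul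
flattenings of tensors [cite: LandsbergGCT2017, §2.4 and §8.2.1 (the map (8.2.1) is a `GL(V)`-module map)] written out for
polynomials; for the catalecticant part it is the symmetry of the apolarity pairing
[cite: LandsbergGCT2017, §6.2.2 (held PDF p. 158)]. (Cell use: it halves every table of Koszul–Young ranks,
`(p,k) ↔ (N-1-p, d-1-k)`; the memo CF3-THEOREM §3b of the cell `pub-gct-max` states it with this proof.)

**What is here.**
* `listDeg l` (the exponent vector `Σ_{i∈l} e_i` of a derivative list), `mfact m = ∏ (m_i)!`, and (file-private) the
  coefficient formula `m! · coeff_m(∂^l P) = (m + listDeg l)! · P_{m + listDeg l}` (`mfact_mul_coeff_iterPDeriv`).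
* `MDeg q e` (exponent vectors of degree `e`, a `Fintype`), the coefficient matrix `kyCoeffMatrix p k e P` (rows
  `(T, β)` with `|T| = p+1`, `|β| = e`; columns `(l, S)` with `|l| = k`, `|S| = p`) and, for a form of degree
  `d = k + 1 + e`, **`kyRankFin K p k P = (kyCoeffMatrix p k e P).rank`** (`kyRankFin_eq_rank_kyCoeffMatrix`) — the bridge
  from the span-of-images definition to `Matrix.rank` (usable for kernel certificates).
* the (file-private) sign identity `ε((S⊔t)ᶜ, t)·ε(S,t) = (-1)^t` (`koszulSign_compl_mul`), the entry relation
  (`kyCoeff_dual_entry`), and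
  **`kyRankFin_dual`**: `kyRankFin K p k P = kyRankFin K (q-1-p) (d-1-k) P` for `P` homogeneous of degree `d`,
  `p + 1 ≤ q`, `k + 1 ≤ d`, `CharZero K`.
-/

noncomputable section

open MvPolynomial

namespace Literature.Computability.AlgebraicComplexity

open Literature.Barriers.ValiantsHypothesis

variable {K : Type*} [Field K] {q : ℕ}

/-! ## Exponent vectors of derivative lists and the coefficient formula for `∂^l` -/

/-- The exponent vector `Σ_{i ∈ l} e_i` of a list of variables (the multi-index of `∂^l`). [folklore] -/
def listDeg (l : List (Fin q)) : Fin q →₀ ℕ := (l.map fun i => Finsupp.single i 1).sum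

/-- `listDeg [] = 0`. [folklore] -/
@[simp] private theorem listDeg_nil : listDeg ([] : List (Fin q)) = 0 := by simp [listDeg]

/-- `listDeg (i :: l) = e_i + listDeg l`. [folklore] -/
@[simp] private theorem listDeg_cons (i : Fin q) (l : List (Fin q)) :
    listDeg (i :: l) = Finsupp.single i 1 + listDeg l := by simp [listDeg]

/-- `|listDeg l| = |l|`. [folklore] -/
private theorem degree_listDeg (l : List (Fin q)) : (listDeg l).degree = l.length := by
  induction l with
  | nil => simp
  | cons i l ih => rw [listDeg_cons, map_add, Finsupp.degree_single, ih, List.length_cons, add_comm]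

/-- `listDeg l i = #occurrences of i in l`. [folklore] -/
private theorem listDeg_apply (l : List (Fin q)) (i : Fin q) : listDeg l i = l.count i := by
  induction l with
  | nil => simp
  | cons j l ih =>
    rw [listDeg_cons, Finsupp.add_apply, ih, List.count_cons, Finsupp.single_apply]
    by_cases h : j = i
    · subst h; simp [add_comm]
    · simp [h]

/-- Every exponent vector is the `listDeg` of the list of its multiset. [folklore] -/
private theorem listDeg_toList (β : Fin q →₀ ℕ) : listDeg (Finsupp.toMultiset β).toList = β := by
  classical
  ext i
  rw [listDeg_apply, ← Multiset.coe_count, Multiset.coe_toList, Finsupp.count_toMultiset]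

/-- The length of that list is the degree. [folklore] -/
private theorem length_toList_toMultiset (β : Fin q →₀ ℕ) : (Finsupp.toMultiset β).toList.length = β.degree := by
  rw [← degree_listDeg, listDeg_toList]

/-- `m! := ∏_i (m_i)!`. [folklore] -/
def mfact (m : Fin q →₀ ℕ) : ℕ := ∏ i, (m i).factorial

/-- `m! > 0`. [folklore] -/
private theorem mfact_pos (m : Fin q →₀ ℕ) : 0 < mfact m := Finset.prod_pos fun _ _ => Nat.factorial_pos _

/-- `m! ≠ 0` in characteristic zero. [folklore] -/
private theorem mfact_cast_ne_zero [CharZero K] (m : Fin q →₀ ℕ) : (mfact m : K) ≠ 0 := by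
  exact_mod_cast (mfact_pos m).ne'

/-- `(m + e_i)! = m! · (m_i + 1)`. [folklore] -/
private theorem mfact_add_single (m : Fin q →₀ ℕ) (i : Fin q) :
    mfact (m + Finsupp.single i 1) = mfact m * (m i + 1) := by
  classical
  unfold mfact
  have h : ∀ j, ((m + Finsupp.single i 1 : Fin q →₀ ℕ) j).factorial =
      (m j).factorial * (if j = i then m i + 1 else 1) := by
    intro j
    by_cases hj : j = i
    · subst hj
      rw [if_pos rfl, Finsupp.add_apply, Finsupp.single_eq_same, Nat.factorial_succ]
      ring
    · rw [if_neg hj, Finsupp.add_apply, Finsupp.single_apply, if_neg (Ne.symm hj), add_zero, mul_one]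
  simp_rw [h, Finset.prod_mul_distrib, Finset.prod_ite_eq', Finset.mem_univ, if_true]

/-- One derivative: `m! · coeff_m(∂_i f) = (m+e_i)! · f_{m+e_i}`. [folklore] -/
private theorem mfact_mul_coeff_pderiv (m : Fin q →₀ ℕ) (i : Fin q) (f : MvPolynomial (Fin q) K) :
    (mfact m : K) * coeff m (pderiv i f) =
      (mfact (m + Finsupp.single i 1) : K) * coeff (m + Finsupp.single i 1) f := by
  rw [coeff_pderiv, mfact_add_single, Nat.cast_mul, Nat.cast_add, Nat.cast_one]
  ring

/-- **Coefficients of iterated derivatives**: `m! · coeff_m(∂^l f) = (m + listDeg l)! · f_{m + listDeg l}`.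
[folklore] -/
private theorem mfact_mul_coeff_iterPDeriv (l : List (Fin q)) (m : Fin q →₀ ℕ) (f : MvPolynomial (Fin q) K) :
    (mfact m : K) * coeff m (iterPDeriv l f) =
      (mfact (m + listDeg l) : K) * coeff (m + listDeg l) f := by
  induction l generalizing m with
  | nil => simp
  | cons i l ih => rw [iterPDeriv_cons, mfact_mul_coeff_pderiv, ih, listDeg_cons, ← add_assoc]

/-! ## Entries of the Koszul–Young images -/

/-- Coefficient of `e_T ⊗ x^β` in the image of `∂^l ⊗ e_S`. [cite: Guan2016, §1.3] -/
theorem coeff_kyImage (f : MvPolynomial (Fin q) K) (l : List (Fin q)) (S T : Finset (Fin q))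
    (β : Fin q →₀ ℕ) :
    coeff β (kyImage f l S T) = ∑ j, if j ∉ S ∧ T = insert j S then
      (koszulSign S j : K) * coeff β (pderiv j (iterPDeriv l f)) else 0 := by
  rw [kyImage_apply, coeff_sum]
  refine Finset.sum_congr rfl fun j _ => ?_
  split_ifs
  · rw [← map_intCast (C : K →+* MvPolynomial (Fin q) K), coeff_C_mul]
  · rw [coeff_zero]

/-- If `T` is not of the form `S ⊔ {j}`, the `e_T`-component of the image of `∂^l ⊗ e_S` vanishes.
[cite: Guan2016, §1.3] -/
theorem kyImage_apply_eq_zero (f : MvPolynomial (Fin q) K) (l : List (Fin q)) (S T : Finset (Fin q))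
    (h : ∀ j, j ∉ S → T ≠ insert j S) : kyImage f l S T = 0 := by
  rw [kyImage_apply]
  exact Finset.sum_eq_zero fun j _ => if_neg fun hj => h j hj.1 hj.2

/-- The `e_{S ⊔ t}`-component of the image of `∂^l ⊗ e_S` is `ε(S,t) ∂_t ∂^l f`. [cite: Guan2016, §1.3] -/
theorem kyImage_apply_insert (f : MvPolynomial (Fin q) K) (l : List (Fin q)) {S : Finset (Fin q)}
    {t : Fin q} (ht : t ∉ S) :
    kyImage f l S (insert t S) =
      (koszulSign S t : MvPolynomial (Fin q) K) * pderiv t (iterPDeriv l f) := by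
  rw [kyImage_apply, Finset.sum_eq_single t]
  · rw [if_pos ⟨ht, rfl⟩]
  · intro j _ hjt
    rw [if_neg]
    rintro ⟨hj, hins⟩
    apply hjt
    have : j ∈ insert t S := by rw [hins]; exact Finset.mem_insert_self j S
    rcases Finset.mem_insert.1 this with h | h
    · exact h
    · exact absurd h hj
  · intro h
    exact absurd (Finset.mem_univ t) h

/-- Images of a form of degree `d` under `∂^l ⊗ e_S`, `|l| = k`, have homogeneous components of degree `d - (k+1)`.
[cite: Guan2016, §1.3] -/
theorem kyImage_isHomogeneous {f : MvPolynomial (Fin q) K} {d : ℕ} (hf : f.IsHomogeneous d)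
    (l : List (Fin q)) (S T : Finset (Fin q)) :
    (kyImage f l S T).IsHomogeneous (d - (l.length + 1)) := by
  classical
  rw [kyImage_apply]
  refine IsHomogeneous.sum _ _ _ fun j _ => ?_
  split_ifs
  · have h1 := isHomogeneous_iterPDeriv hf (j :: l)
    rw [iterPDeriv_cons, List.length_cons] at h1
    rw [← map_intCast (C : K →+* MvPolynomial (Fin q) K)]
    simpa using (isHomogeneous_C (Fin q) ((koszulSign S j : ℤ) : K)).mul h1
  · exact isHomogeneous_zero _ _ _

/-! ## The coefficient matrix and `kyRankFin = Matrix.rank` -/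

/-- Exponent vectors of degree `e` in `q` variables (the monomial basis of `S^e`). [folklore] -/
abbrev MDeg (q e : ℕ) : Type := {β : Fin q →₀ ℕ // β.degree = e}

/-- `MDeg q e` is finite (the antidiagonal). [folklore] -/
instance instFintypeMDeg (q e : ℕ) : Fintype (MDeg q e) :=
  Fintype.subtype ((Finset.univ : Finset (Fin q)).finsuppAntidiag e)
    fun β => (degree_eq_iff_mem_finsuppAntidiag β e).symm

/-- **The coefficient matrix of `P^{∧p}_{k,d-k}` in degree `e`**: row `(T, β)` (`|T| = p+1`, `|β| = e`), column
`(l, S)` (`l` a list of `k` variables, `|S| = p`), entry `coeff_β` of the `e_T`-component of the image of `∂^l ⊗ e_S`.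
(Columns are over-parametrised by LISTS rather than multi-indices; this does not change the column span.)
[cite: LandsbergGCT2017, §8.2.1 eq. (8.2.1)] [cite: Guan2016, §1.3] -/
def kyCoeffMatrix (p k e : ℕ) (f : MvPolynomial (Fin q) K) :
    Matrix (PSub q (p + 1) × MDeg q e) (List.Vector (Fin q) k × PSub q p) K :=
  Matrix.of fun r c => coeff r.2.1 (kyImage f c.1.toList c.2.1 r.1.1)

/-- The coordinate map `v ↦ ((T,β) ↦ coeff_β (v T))` on the relevant coordinates. [folklore] -/
def kyCoord (q p e : ℕ) (K : Type*) [Field K] :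
    (Finset (Fin q) → MvPolynomial (Fin q) K) →ₗ[K] (PSub q (p + 1) × MDeg q e → K) where
  toFun v := fun r => coeff r.2.1 (v r.1.1)
  map_add' v w := by funext r; simp
  map_smul' c v := by funext r; simp

/-- Unfolding lemma. [folklore] -/
@[simp] private theorem kyCoord_apply (p e : ℕ) (v : Finset (Fin q) → MvPolynomial (Fin q) K)
    (r : PSub q (p + 1) × MDeg q e) : kyCoord q p e K v r = coeff r.2.1 (v r.1.1) := rfl

/-- The columns of the coefficient matrix are the coordinate vectors of the Koszul–Young images.
[cite: LandsbergGCT2017, §8.2.1 eq. (8.2.1)] [cite: Guan2016, §1.3] -/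
theorem range_col_kyCoeffMatrix (p k e : ℕ) (f : MvPolynomial (Fin q) K) :
    Set.range (kyCoeffMatrix p k e f).col = kyCoord q p e K '' kyImages p k f := by
  ext w
  constructor
  · rintro ⟨c, rfl⟩
    refine ⟨kyImage f c.1.toList c.2.1, ⟨c.1.toList, c.2.1, c.1.toList_length, c.2.2, rfl⟩, ?_⟩
    funext r
    rfl
  · rintro ⟨_, ⟨l, S, hl, hS, rfl⟩, rfl⟩
    refine ⟨(⟨l, hl⟩, ⟨S, hS⟩), ?_⟩
    funext r
    rfl

/-- The shape of every vector in the image of the flattening of a form of degree `d = k + 1 + e`: supported on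
`|T| = p + 1`, with homogeneous components of degree `e`. [folklore] -/
private def kyShape (q p e : ℕ) (K : Type*) [Field K] :
    Submodule K (Finset (Fin q) → MvPolynomial (Fin q) K) where
  carrier := {v | ∀ T, (T.card ≠ p + 1 → v T = 0) ∧ v T ∈ homogeneousSubmodule (Fin q) K e}
  add_mem' := by
    intro v w hv hw T
    refine ⟨fun hT => ?_, Submodule.add_mem _ (hv T).2 (hw T).2⟩
    rw [Pi.add_apply, (hv T).1 hT, (hw T).1 hT, add_zero]
  zero_mem' := fun T => ⟨fun _ => rfl, Submodule.zero_mem _⟩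
  smul_mem' := by
    intro c v hv T
    refine ⟨fun hT => ?_, Submodule.smul_mem _ c (hv T).2⟩
    rw [Pi.smul_apply, (hv T).1 hT, smul_zero]

/-- The images of a form of degree `k + 1 + e` have the shape `kyShape q p e`. [folklore] -/
private theorem span_kyImages_le_kyShape {f : MvPolynomial (Fin q) K} {d p k e : ℕ}
    (hf : f.IsHomogeneous d) (he : k + 1 + e = d) :
    Submodule.span K (kyImages p k f) ≤ kyShape q p e K := by
  classical
  rw [Submodule.span_le]
  rintro _ ⟨l, S, hl, hS, rfl⟩ T
  refine ⟨fun hT => kyImage_apply_eq_zero f l S T fun j hj hins => hT ?_, ?_⟩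
  · rw [hins, Finset.card_insert_of_notMem hj, hS]
  · have h := kyImage_isHomogeneous hf l S T
    rw [hl, show d - (k + 1) = e by omega] at h
    exact (mem_homogeneousSubmodule e _).2 h

/-- The coordinate map is injective on vectors of that shape. [folklore] -/
private theorem kyCoord_injOn_kyShape {p e : ℕ} {v : Finset (Fin q) → MvPolynomial (Fin q) K}
    (hv : v ∈ kyShape q p e K) (h0 : kyCoord q p e K v = 0) : v = 0 := by
  funext T
  rw [Pi.zero_apply]
  by_cases hT : T.card = p + 1
  · have hhom : (v T).IsHomogeneous e := (mem_homogeneousSubmodule e _).1 (hv T).2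
    ext β
    rw [coeff_zero]
    by_cases hβ : β.degree = e
    · have := congrArg (fun w => w (⟨T, hT⟩, ⟨β, hβ⟩)) h0
      simpa using this
    · exact hhom.coeff_eq_zero hβ
  · exact (hv T).1 hT

/-- **`rank P^{∧p}_{k,d-k}` is the rank of the coefficient matrix** (for a form `P` of degree `d = k + 1 + e`).
[cite: LandsbergGCT2017, §8.2.1 eq. (8.2.1)] [cite: Guan2016, §1.3] -/
theorem kyRankFin_eq_rank_kyCoeffMatrix {f : MvPolynomial (Fin q) K} {d : ℕ} (hf : f.IsHomogeneous d)
    (p k e : ℕ) (he : k + 1 + e = d) :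
    kyRankFin K p k f = (kyCoeffMatrix p k e f).rank := by
  classical
  set W := Submodule.span K (kyImages p k f) with hW
  have hinj : Function.Injective ((kyCoord q p e K).domRestrict W) := by
    intro x y hxy
    apply Subtype.ext
    have h0 : kyCoord q p e K (x.1 - y.1) = 0 := by
      rw [map_sub, sub_eq_zero]; exact hxy
    have := kyCoord_injOn_kyShape ((span_kyImages_le_kyShape hf he) (W.sub_mem x.2 y.2)) h0
    exact sub_eq_zero.1 this
  have h1 : Module.finrank K W = Module.finrank K (W.map (kyCoord q p e K)) := by
    rw [← LinearMap.finrank_range_of_inj hinj, LinearMap.range_domRestrict]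
  rw [kyRankFin, ← hW, h1, hW, Submodule.map_span, ← range_col_kyCoeffMatrix,
    Matrix.rank_eq_finrank_span_cols]

/-! ## The transpose duality -/

section Duality

/-- `Σ_{s ∈ S} s` parity sign. [folklore] -/
def setSign (S : Finset (Fin q)) : K := (-1) ^ (∑ s ∈ S, (s : ℕ))

/-- `setSign (S ⊔ t) = (-1)^t · setSign S`. [folklore] -/
private theorem setSign_insert {S : Finset (Fin q)} {t : Fin q} (ht : t ∉ S) :
    (setSign (insert t S) : K) = (-1) ^ (t : ℕ) * setSign S := by
  unfold setSign
  rw [Finset.sum_insert ht, pow_add]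

/-- `setSign S · setSign S = 1`. [folklore] -/
private theorem setSign_mul_self (S : Finset (Fin q)) : (setSign S : K) * setSign S = 1 := by
  unfold setSign
  rw [← pow_add, ← two_mul, pow_mul]
  simp

/-- `setSign S ≠ 0`. [folklore] -/
private theorem setSign_ne_zero (S : Finset (Fin q)) : (setSign S : K) ≠ 0 := by
  intro h
  have := setSign_mul_self (K := K) S
  rw [h, zero_mul] at this
  exact zero_ne_one this

/-- **The Koszul signs of a subset and of the complement of its successor**:
`ε((S ⊔ t)ᶜ, t) · ε(S, t) = (-1)^t` (the elements below `t` split between `S` and `(S ⊔ t)ᶜ`; no hypothesis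
`t ∉ S` is needed). [folklore] -/
private theorem koszulSign_compl_mul (S : Finset (Fin q)) (t : Fin q) :
    koszulSign (insert t S)ᶜ t * koszulSign S t = (-1) ^ (t : ℕ) := by
  classical
  unfold koszulSign
  rw [← pow_add]
  congr 1
  -- count the elements below `t`
  have hsplit := Finset.card_filter_add_card_filter_not
    (s := (Finset.univ : Finset (Fin q)).filter (· < t)) (fun s => s ∈ insert t S)
  have hA : ((Finset.univ : Finset (Fin q)).filter (· < t)).filter (fun s => s ∈ insert t S) =
      S.filter (· < t) := by
    ext s
    simp only [Finset.mem_filter, Finset.mem_univ, true_and, Finset.mem_insert]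
    constructor
    · rintro ⟨hs, h | h⟩
      · exact absurd hs (h ▸ lt_irrefl t)
      · exact ⟨h, hs⟩
    · rintro ⟨h, hs⟩
      exact ⟨hs, Or.inr h⟩
  have hB : ((Finset.univ : Finset (Fin q)).filter (· < t)).filter (fun s => ¬ s ∈ insert t S) =
      (insert t S)ᶜ.filter (· < t) := by
    ext s
    simp only [Finset.mem_filter, Finset.mem_univ, true_and, Finset.mem_compl]
    exact and_comm
  have hC : ((Finset.univ : Finset (Fin q)).filter (· < t)) = Finset.Iio t := by
    ext s
    simp
  rw [hA, hB, hC, Fin.card_Iio] at hsplit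
  omega

/-- One direction of `compl_eq_insert_iff`. [folklore] -/
private theorem compl_eq_insert_aux {S S' : Finset (Fin q)} {t : Fin q} (ht : t ∉ S')
    (h : Sᶜ = insert t S') : t ∉ S ∧ S'ᶜ = insert t S := by
  have hS : S = (insert t S')ᶜ := by rw [← h, compl_compl]
  subst hS
  refine ⟨fun hmem => (Finset.mem_compl.1 hmem) (Finset.mem_insert_self t S'), ?_⟩
  ext s
  simp only [Finset.mem_compl, Finset.mem_insert, not_or]
  constructor
  · intro hs
    by_cases hst : s = t
    · exact Or.inl hst
    · exact Or.inr ⟨hst, hs⟩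
  · rintro (hst | ⟨_, hs⟩)
    · rw [hst]; exact ht
    · exact hs

/-- Complement bookkeeping: `Sᶜ = S' ⊔ t` with `t ∉ S'` iff `S'ᶜ = S ⊔ t` with `t ∉ S`. [folklore] -/
private theorem compl_eq_insert_iff (S S' : Finset (Fin q)) (t : Fin q) :
    (t ∉ S' ∧ Sᶜ = insert t S') ↔ (t ∉ S ∧ S'ᶜ = insert t S) :=
  ⟨fun h => compl_eq_insert_aux h.1 h.2, fun h => compl_eq_insert_aux h.1 h.2⟩

/-- **The entry relation** between the two flattenings: for lists `l`, `l'` and subsets `S`, `S'`,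
`setSign S · (listDeg l)! · coeff_{listDeg l}(image of ∂^{l'} ⊗ e_{S'} at e_{Sᶜ})
 = setSign S'ᶜ · (listDeg l')! · coeff_{listDeg l'}(image of ∂^{l} ⊗ e_{S} at e_{S'ᶜ})`. [cite: LandsbergGCT2017, §8.2.1] -/
theorem kyCoeff_dual_entry (f : MvPolynomial (Fin q) K) (l l' : List (Fin q)) (S S' : Finset (Fin q)) :
    (setSign S : K) * (mfact (listDeg l) : K) * coeff (listDeg l) (kyImage f l' S' Sᶜ) =
      (setSign S'ᶜ : K) * (mfact (listDeg l') : K) * coeff (listDeg l') (kyImage f l S S'ᶜ) := by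
  classical
  by_cases hadj : ∃ t, t ∉ S' ∧ Sᶜ = insert t S'
  · obtain ⟨t, ht', hSc⟩ := hadj
    obtain ⟨ht, hS'c⟩ := (compl_eq_insert_iff S S' t).1 ⟨ht', hSc⟩
    rw [hSc, hS'c, kyImage_apply_insert f l' ht', kyImage_apply_insert f l ht,
      ← map_intCast (C : K →+* MvPolynomial (Fin q) K) (koszulSign S' t), coeff_C_mul,
      ← map_intCast (C : K →+* MvPolynomial (Fin q) K) (koszulSign S t), coeff_C_mul]
    -- the two coefficient parts agree after multiplying by the factorials
    have hA : (mfact (listDeg l) : K) * coeff (listDeg l) (pderiv t (iterPDeriv l' f)) =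
        (mfact (listDeg l + listDeg (t :: l')) : K) * coeff (listDeg l + listDeg (t :: l')) f := by
      rw [← iterPDeriv_cons, mfact_mul_coeff_iterPDeriv]
    have hB : (mfact (listDeg l') : K) * coeff (listDeg l') (pderiv t (iterPDeriv l f)) =
        (mfact (listDeg l' + listDeg (t :: l)) : K) * coeff (listDeg l' + listDeg (t :: l)) f := by
      rw [← iterPDeriv_cons, mfact_mul_coeff_iterPDeriv]
    have hγ : listDeg l + listDeg (t :: l') = listDeg l' + listDeg (t :: l) := by
      rw [listDeg_cons, listDeg_cons]; abel
    rw [hγ] at hA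
    -- signs: ε(S',t) = ε((S ⊔ t)ᶜ, t) and ε((S⊔t)ᶜ,t) ε(S,t) = (-1)^t, setSign S'ᶜ = (-1)^t setSign S
    have hS' : S' = (insert t S)ᶜ := by rw [← hS'c, compl_compl]
    have hsign : (koszulSign S' t : K) * (koszulSign S t : K) = (-1) ^ (t : ℕ) := by
      have h := congrArg (fun z : ℤ => (z : K)) (koszulSign_compl_mul S t)
      simp only [Int.cast_mul, Int.cast_pow, Int.cast_neg, Int.cast_one] at h
      rw [hS']
      exact h
    have hset : (setSign (insert t S) : K) = (-1) ^ (t : ℕ) * setSign S := setSign_insert ht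
    have hεε : (koszulSign S t : K) * (koszulSign S t : K) = 1 := by
      have h := congrArg (fun z : ℤ => (z : K)) (koszulSign_mul_self S t)
      simp only [Int.cast_mul, Int.cast_one] at h
      exact h
    -- assemble
    calc (setSign S : K) * (mfact (listDeg l) : K) * ((koszulSign S' t : K) *
            coeff (listDeg l) (pderiv t (iterPDeriv l' f)))
        = setSign S * (koszulSign S' t : K) *
            ((mfact (listDeg l) : K) * coeff (listDeg l) (pderiv t (iterPDeriv l' f))) := by ring
      _ = setSign S * (koszulSign S' t : K) *
            ((mfact (listDeg l') : K) * coeff (listDeg l') (pderiv t (iterPDeriv l f))) := by rw [hA, hB]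
      _ = setSign S * ((koszulSign S' t : K) * ((koszulSign S t : K) * (koszulSign S t : K))) *
            ((mfact (listDeg l') : K) * coeff (listDeg l') (pderiv t (iterPDeriv l f))) := by
              rw [hεε, mul_one]
      _ = setSign S * (((koszulSign S' t : K) * (koszulSign S t : K)) * (koszulSign S t : K)) *
            ((mfact (listDeg l') : K) * coeff (listDeg l') (pderiv t (iterPDeriv l f))) := by ring
      _ = (setSign (insert t S) : K) * (mfact (listDeg l') : K) * ((koszulSign S t : K) *
            coeff (listDeg l') (pderiv t (iterPDeriv l f))) := by rw [hsign, hset]; ring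
  · -- both sides vanish
    have h1 : kyImage f l' S' Sᶜ = 0 :=
      kyImage_apply_eq_zero f l' S' Sᶜ fun j hj hins => hadj ⟨j, hj, hins⟩
    have h2 : kyImage f l S S'ᶜ = 0 := by
      refine kyImage_apply_eq_zero f l S S'ᶜ fun j hj hins => hadj ?_
      exact ⟨j, ((compl_eq_insert_iff S S' j).2 ⟨hj, hins⟩).1, ((compl_eq_insert_iff S S' j).2 ⟨hj, hins⟩).2⟩
    rw [h1, h2, coeff_zero, coeff_zero, mul_zero, mul_zero]

variable [CharZero K]

/-- **Transpose duality of Koszul–Young flattenings**: for a form `P` of degree `d` in `q` variables over a field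
of characteristic zero, `rank P^{∧p}_{k,d-k} = rank P^{∧(q-1-p)}_{d-1-k,k+1}` (`p + 1 ≤ q`, `k + 1 ≤ d`): the two
coefficient matrices are transposes of each other up to invertible diagonal scalings and a relabelling of the
bases by complements. [cite: LandsbergGCT2017, §8.2.1 (the map (8.2.1) is a `GL(V)`-module map) and §2.4]
[cite: LandsbergGCT2017, §6.2.2 (held PDF p. 158)] -/
theorem kyRankFin_dual {f : MvPolynomial (Fin q) K} {d : ℕ} (hf : f.IsHomogeneous d) (p k : ℕ)
    (hp : p + 1 ≤ q) (hk : k + 1 ≤ d) :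
    kyRankFin K p k f = kyRankFin K (q - 1 - p) (d - 1 - k) f := by
  classical
  -- the two coefficient matrices
  set e := d - 1 - k with he_def
  have he : k + 1 + e = d := by omega
  have he' : (d - 1 - k) + 1 + k = d := by omega
  rw [kyRankFin_eq_rank_kyCoeffMatrix hf p k e he, kyRankFin_eq_rank_kyCoeffMatrix hf (q - 1 - p) (d - 1 - k) k he']
  set M := kyCoeffMatrix p k e f with hM
  set M' := kyCoeffMatrix (q - 1 - p) (d - 1 - k) k f with hM'
  -- index types
  -- Col  = List.Vector (Fin q) k × PSub q p           (columns of M)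
  -- Row' = PSub q (q - 1 - p + 1) × MDeg q k          (rows of M')
  -- the surjection π : Col → Row', (l, S) ↦ (Sᶜ, listDeg l)
  have hcardc : ∀ S : PSub q p, (S.1ᶜ).card = q - 1 - p + 1 := by
    intro S; rw [Finset.card_compl, Fintype.card_fin, S.2]; omega
  let π : List.Vector (Fin q) k × PSub q p → PSub q (q - 1 - p + 1) × MDeg q k :=
    fun c => (⟨c.2.1ᶜ, hcardc c.2⟩, ⟨listDeg c.1.toList, by rw [degree_listDeg, c.1.toList_length]⟩)
  have hπ : Function.Surjective π := by
    rintro ⟨⟨T', hT'⟩, ⟨α, hα⟩⟩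
    refine ⟨(⟨(Finsupp.toMultiset α).toList, by rw [length_toList_toMultiset, hα]⟩, ⟨T'ᶜ, ?_⟩), ?_⟩
    · rw [Finset.card_compl, Fintype.card_fin, hT']; omega
    · simp only [π]
      ext1
      · exact Subtype.ext (compl_compl T')
      · exact Subtype.ext (listDeg_toList α)
  -- pull-back along π : injective linear map (Row' → K) → (Col → K)
  let πstar : (PSub q (q - 1 - p + 1) × MDeg q k → K) →ₗ[K] (List.Vector (Fin q) k × PSub q p → K) :=
    { toFun := fun w => w ∘ π
      map_add' := fun _ _ => rfl
      map_smul' := fun _ _ => rfl }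
  have hπstar : Function.Injective πstar := by
    intro w w' h
    funext r
    obtain ⟨c, rfl⟩ := hπ r
    exact congrFun h c
  -- the diagonal scaling Δ on (Col → K): coordinate (l,S) multiplied by (setSign S · (listDeg l)!)⁻¹
  let u : List.Vector (Fin q) k × PSub q p → K := fun c => ((setSign c.2.1 : K) * (mfact (listDeg c.1.toList) : K))⁻¹
  have hu : ∀ c, u c ≠ 0 := fun c =>
    inv_ne_zero (mul_ne_zero (setSign_ne_zero _) (mfact_cast_ne_zero _))
  let Δ : (List.Vector (Fin q) k × PSub q p → K) →ₗ[K] (List.Vector (Fin q) k × PSub q p → K) :=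
    { toFun := fun w c => u c * w c
      map_add' := fun _ _ => by funext c; simp [mul_add]
      map_smul' := fun _ _ => by funext c; simp [mul_left_comm] }
  have hΔ : Function.Injective Δ := by
    intro w w' h
    funext c
    have := congrFun h c
    exact mul_left_cancel₀ (hu c) this
  -- rows of M as vectors on Col
  let R : PSub q (p + 1) × MDeg q e → (List.Vector (Fin q) k × PSub q p → K) := fun r c => M r c
  -- KEY: pulled-back columns of M' are scaled, Δ-transformed rows of M
  have hcardT : ∀ S' : PSub q (q - 1 - p), (S'.1ᶜ).card = p + 1 := by
    intro S'; rw [Finset.card_compl, Fintype.card_fin, S'.2]; omega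
  let ρ : List.Vector (Fin q) (d - 1 - k) × PSub q (q - 1 - p) → PSub q (p + 1) × MDeg q e :=
    fun c' => (⟨c'.2.1ᶜ, hcardT c'.2⟩, ⟨listDeg c'.1.toList, by rw [degree_listDeg, c'.1.toList_length]⟩)
  have hρ : Function.Surjective ρ := by
    rintro ⟨⟨T, hT⟩, ⟨β, hβ⟩⟩
    refine ⟨(⟨(Finsupp.toMultiset β).toList, by rw [length_toList_toMultiset, hβ]⟩, ⟨Tᶜ, ?_⟩), ?_⟩
    · rw [Finset.card_compl, Fintype.card_fin, hT]; omega
    · simp only [ρ]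
      ext1
      · exact Subtype.ext (compl_compl T)
      · exact Subtype.ext (listDeg_toList β)
  have hkey : ∀ c', πstar (M'.col c') =
      ((setSign c'.2.1ᶜ : K) * (mfact (listDeg c'.1.toList) : K)) • Δ (R (ρ c')) := by
    intro c'
    funext c
    -- unfold everything to coefficients
    change coeff (listDeg c.1.toList) (kyImage f c'.1.toList c'.2.1 c.2.1ᶜ) =
      ((setSign c'.2.1ᶜ : K) * (mfact (listDeg c'.1.toList) : K)) *
        (((setSign c.2.1 : K) * (mfact (listDeg c.1.toList) : K))⁻¹ *
          coeff (listDeg c'.1.toList) (kyImage f c.1.toList c.2.1 c'.2.1ᶜ))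
    have h := kyCoeff_dual_entry f c.1.toList c'.1.toList c.2.1 c'.2.1
    have hne : (setSign c.2.1 : K) * (mfact (listDeg c.1.toList) : K) ≠ 0 :=
      mul_ne_zero (setSign_ne_zero _) (mfact_cast_ne_zero _)
    calc coeff (listDeg c.1.toList) (kyImage f c'.1.toList c'.2.1 c.2.1ᶜ)
        = ((setSign c.2.1 : K) * (mfact (listDeg c.1.toList) : K))⁻¹ *
            ((setSign c.2.1 : K) * (mfact (listDeg c.1.toList) : K) *
              coeff (listDeg c.1.toList) (kyImage f c'.1.toList c'.2.1 c.2.1ᶜ)) := by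
          rw [← mul_assoc, inv_mul_cancel₀ hne, one_mul]
      _ = ((setSign c.2.1 : K) * (mfact (listDeg c.1.toList) : K))⁻¹ *
            ((setSign c'.2.1ᶜ : K) * (mfact (listDeg c'.1.toList) : K) *
              coeff (listDeg c'.1.toList) (kyImage f c.1.toList c.2.1 c'.2.1ᶜ)) := by rw [h]
      _ = _ := by ring
  -- spans
  have hspan : (Submodule.span K (Set.range M'.col)).map πstar =
      (Submodule.span K (Set.range R)).map Δ := by
    rw [Submodule.map_span, Submodule.map_span, ← Set.range_comp, ← Set.range_comp]
    apply le_antisymm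
    · rw [Submodule.span_le]
      rintro _ ⟨c', rfl⟩
      rw [Function.comp_apply, hkey c']
      exact Submodule.smul_mem _ _ (Submodule.subset_span ⟨ρ c', rfl⟩)
    · rw [Submodule.span_le]
      rintro _ ⟨r, rfl⟩
      obtain ⟨c', rfl⟩ := hρ r
      have hc : ((setSign c'.2.1ᶜ : K) * (mfact (listDeg c'.1.toList) : K)) ≠ 0 :=
        mul_ne_zero (setSign_ne_zero _) (mfact_cast_ne_zero _)
      have : (Δ ∘ R) (ρ c') = ((setSign c'.2.1ᶜ : K) * (mfact (listDeg c'.1.toList) : K))⁻¹ •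
          (πstar ∘ M'.col) c' := by
        rw [Function.comp_apply, Function.comp_apply, hkey c', smul_smul, inv_mul_cancel₀ hc, one_smul]
      rw [this]
      exact Submodule.smul_mem _ _ (Submodule.subset_span ⟨c', rfl⟩)
  -- finranks
  have h1 : M'.rank = Module.finrank K ((Submodule.span K (Set.range M'.col)).map πstar) := by
    rw [Matrix.rank_eq_finrank_span_cols, (Submodule.equivMapOfInjective πstar hπstar _).finrank_eq]
  have h2 : Module.finrank K ((Submodule.span K (Set.range R)).map Δ) =
      Module.finrank K (Submodule.span K (Set.range R)) :=
    ((Submodule.equivMapOfInjective Δ hΔ _).finrank_eq).symm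
  have h3 : Module.finrank K (Submodule.span K (Set.range R)) = M.transpose.rank := by
    rw [Matrix.rank_eq_finrank_span_cols]
    rfl
  rw [h1, hspan, h2, h3, Matrix.rank_transpose]

end Duality

end Literature.Computability.AlgebraicComplexity
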